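import Mathlib
import Summits.NavierStokesRegularity.NavierStokesRegularity.Theorems.TaoLadderRungTwoFlatNearBehindStepHalo
import Summits.NavierStokesRegularity.NavierStokesRegularity.Theorems.TaoLadderRungTwoFlatFlowSymmetriesOn
import HarnessLib

/-!
# The CO-SCALED REFERENCE FAMILY (theory-1 g49 TRAP #25, cure (α)): one exact reference flow per tube state, `W_z(t) = x_z·U(x_z·t)`
  (helper for the K_A♭ parent item stmt-NavierStokesRegularity-22987 `FlatGapCertificatesV2`, child 2A `GradedAdiabaticWakeA` of route
  TaoLadderRungTwoFlat; cell harvest/h2-tao-ladder, p1 g24; LADDER §64 (64.7–64.9))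

TRAP #25: measuring the hop flow against ONE fixed reference flow `W` of the pulse `u⋆` floors every deviation at `γ·|u⋆|` (the anchor
band of `AnchorClause`), which kills the booked core inputs on late rows. Cure (α): compare the premise from tube state `z` with the member
of the pulse family selected by its own anchor scale `x_z = anchorScale P i₀ z`, i.e. with `W_z := scaleFam x_z U` where `U` is an exact
zero-slack flow of `u⋆` (scaling covariance of the quadratic lattice, `pseudoFlowOnShift_scale`). This module supplies the three facts the
(α)-shaped step/assembly theorems (`HopTube.tubeStepNearBehindR54_of_schedule_iface`, `tubeStepLandWith_of_schedule_iface`) consume: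

* `coScaled_pseudoFlowOnShift` — for `0 < x ≤ 1`, `scaleFam x U` is an exact zero-slack flow on `[0, c₀]` from `x·U₀` whenever `U` is one on
  `[0, τ_U] ⊇ [0, c₀]` (the `hWflow` family, common horizon `c₀`);
* `abs_scaleFam_le` — template bounds transfer: `|U i m| ≤ M` on `[0, c₀]` gives `|scaleFam x U i m| ≤ M` on `[0, c₀]` (`hM`, `hM₁`, `hM₂`);
* `coScaled_start_mismatch_eq_zero` — with `U₀ = u⋆` the start mismatch `x_z·u⋆ − W_z(0)` vanishes identically, so the `hEW` energy is `0`;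
* `anchorScale_pos_of_anchorClause`, `anchorScale_le_one_of_anchorClause` — `0 < x_z ≤ 1` on the tube (`γ n < 1`).

HONEST FRAMING: bookkeeping over the cell's typed frame and the landed scaling covariance (MODEL lattice, graded mirror table on `S♭`); the
existence of the pulse flow `U` is an INPUT (child 1 `MirrorSolitaryWave`); nothing certified; no item closed; nothing about the Navier–Stokes
equations.
-/

noncomputable section

-- the sub-problem namespace repeats the summit name by design (D-0017)
set_option linter.dupNamespace false

namespace Summit.NavierStokesRegularity.NavierStokesRegularity.Theorems.HopTube

open Set Finset Literature.Analysis.FluidPDE Literature.Analysis.FluidPDE.TaoCascade MirrorPulse GappedFrontRobustOn FlowSymmetry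

variable {ε ε₀ : ℝ}

/-- **The co-scaled member is an exact flow on the clock window.** [cite: Tao2016AveragedNS, §4 Lemma 4.1 (4.5), (4.8)–(4.10) (homogeneity of (4.8)); cell LADDER §64 (TRAP #25 cure (α))] -/
theorem coScaled_pseudoFlowOnShift {τU c₀ : ℝ} {U₀ : Fin 2 → ℤ → ℝ} {U FU : Fin 2 → ℤ → ℝ → ℝ}
    (hU : PseudoFlowOnShift shiftSetFlat τU ε₀ (mirrorTable ε ε) 0 0 U₀ (fun i k => (1 / 2) * U₀ i k ^ 2) (fun _ _ => 0) U FU)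
    (hε₀ : -1 ≤ ε₀) (hc₀ : 0 < c₀) (hcτ : c₀ ≤ τU) {x : ℝ} (hx0 : 0 < x) (hx1 : x ≤ 1) :
    PseudoFlowOnShift shiftSetFlat c₀ ε₀ (mirrorTable ε ε) 0 0 (fun i k => x * U₀ i k)
      (fun i k => (1 / 2) * (x * U₀ i k) ^ 2) (fun _ _ => 0) (scaleFam x U) (fun i k t => (1 / 2) * scaleFam x U i k t ^ 2) := by
  have hτU : 0 < τU := hc₀.trans_le hcτ
  have h := pseudoFlowOnShift_scale (𝕊 := shiftSetFlat) (α := mirrorTable ε ε) (by linarith) hτU hU hx0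
  refine pseudoFlowOnShift_mono h hc₀ ?_
  rw [le_div_iff₀ hx0]
  calc c₀ * x ≤ c₀ * 1 := mul_le_mul_of_nonneg_left hx1 hc₀.le
    _ = c₀ := mul_one _
    _ ≤ τU := hcτ

/-- **Template transfer to the co-scaled member**: `|U i m s| ≤ M` on `[0, c₀]` and `0 ≤ x ≤ 1` give `|x·U i m (x·s)| ≤ M` on `[0, c₀]`.
[folklore (monotonicity); cell LADDER §64 (TRAP #25 cure (α))] -/
theorem abs_scaleFam_le {c₀ M x : ℝ} {U : Fin 2 → ℤ → ℝ → ℝ} {i : Fin 2} {m : ℤ}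
    (hMU : ∀ s ∈ Icc 0 c₀, |U i m s| ≤ M) (hx0 : 0 ≤ x) (hx1 : x ≤ 1) :
    ∀ s ∈ Icc 0 c₀, |scaleFam x U i m s| ≤ M := by
  intro s hs
  have hxs : x * s ∈ Icc 0 c₀ := by
    refine ⟨mul_nonneg hx0 hs.1, ?_⟩
    calc x * s ≤ 1 * s := mul_le_mul_of_nonneg_right hx1 hs.1
      _ = s := one_mul _
      _ ≤ c₀ := hs.2
  have hM := hMU (x * s) hxs
  have hM0 : 0 ≤ M := (abs_nonneg _).trans hM
  simp only [scaleFam, abs_mul, abs_of_nonneg hx0]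
  calc x * |U i m (x * s)| ≤ 1 * M := mul_le_mul hx1 hM (abs_nonneg _) zero_le_one
    _ = M := one_mul _

/-- **The start mismatch of the co-scaled member vanishes**: with `U₀ = u⋆`, the near-zone mismatch energy of `hEW` is that of the zero
family, i.e. `0`. [folklore (definitional); cell LADDER §64 (TRAP #25 cure (α), `hEW ≡ 0`)] -/
theorem coScaled_start_mismatch_eq_zero (P : TubeSchedule) (i₀ : Fin 2) (ustar z : Fin 2 → ℤ → ℝ) (s : Finset ℤ) (θ ne : ℝ) :
    coMovingEnergyOn s θ ne (fun i k _ => anchorScale P i₀ z * ustar i k - anchorScale P i₀ z * ustar i k) 0 = 0 := by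
  unfold coMovingEnergyOn
  simp

/-- On the tube (anchor band with `γ n < 1`) the anchor scale is positive. [cite: Tao2016AveragedNS, §6.4 (statement shape); cell LADDER §50 (anchor band)] -/
theorem anchorScale_pos_of_anchorClause (P : TubeSchedule) {i₀ : Fin 2} {n : ℕ} {z : Fin 2 → ℤ → ℝ} (hA : 0 < P.Astar)
    (hγ : P.γ n < 1) (h : AnchorClause P i₀ n z) : 0 < anchorScale P i₀ z := by
  unfold anchorScale
  have h1 : 0 < P.Astar * (1 - P.γ n) := mul_pos hA (by linarith)
  exact div_pos (h1.trans_le h.1) hA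

/-- On the tube the anchor scale is at most `1`. [cite: Tao2016AveragedNS, §6.4 (statement shape); cell LADDER §50 (anchor band)] -/
theorem anchorScale_le_one_of_anchorClause (P : TubeSchedule) {i₀ : Fin 2} {n : ℕ} {z : Fin 2 → ℤ → ℝ} (hA : 0 < P.Astar)
    (h : AnchorClause P i₀ n z) : anchorScale P i₀ z ≤ 1 := by
  unfold anchorScale
  rw [div_le_one hA]
  exact h.2

end Summit.NavierStokesRegularity.NavierStokesRegularity.Theorems.HopTube

end
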